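import Literature.MathematicalPhysics.PowerSystems.RingNormalOperationCensus
import HarnessLib

/-!
# Manik–Timme–Witthaut's Theorem 12: the number of normal-operation synchronous states of a
# LOADED ring `R_N` is `⌈ϖ(f_max)⌉ − ⌊ϖ(f_min)⌋ − 1`, `ϖ(f) = (1/2π)Σⱼ arcsin((F⁰ⱼ + f)/Kⱼ)` the
# winding number of the cycle flow `f` — and (Cor. 1) every one of them is STABLE

Topic `Literature/MathematicalPhysics/PowerSystems`, namespace
`Literature.MathematicalPhysics.PowerSystems.ClassicalModel`. Sequel of
`RingNormalOperationCensus.lean` (gridfusion-lit-1: the UNLOADED homogeneous ring, `P ≡ 0`,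
`𝒩 = 2⌈N/4⌉ − 1`). Here the printed theorem in full: ARBITRARY injections `Pₖ` (synchronous
frequency `ω_s = ΣP/ΣD`), ARBITRARY positive line capacities `Kₖ` on the ring edges `(k, ρk)`,
counted through ANY reference flow `F⁰` — for a lossless network-reduced swing model
`S : LosslessSystem (n+1) 0` whose coupling is a ring. Everything below is PROVED (no definition,
no named fact, no new axiom).

SOURCE (read on the page this session). D. Manik, M. Timme, D. Witthaut, *Cycle flows and
multistability in oscillatory networks*, Chaos 27 (2017) 083123 [ManikTimmeWitthaut2017]
(`lit read arxiv:1611.09825`, chunk p0012 L60–L120). **Theorem 12.** «For a ring network R_N, the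
number of normal operation fixed point (denoted by 𝒩) is given by
𝒩 = ⌈(1/2π)Σⱼ arcsin((F⁽⁰⁾_{j+1,j} + f^max_c)/K_{j+1,j})⌉ − ⌊(1/2π)Σⱼ arcsin((F⁽⁰⁾_{j+1,j} + f^min_c)/K_{j+1,j})⌋ − 1,
where … F⁽⁰⁾ᵢⱼ is one particular solution to the dynamic condition and
f^max_c = minⱼ(K_{j+1,j} − F⁽⁰⁾_{j+1,j}), f^min_c = maxⱼ(−K_{j+1,j} − F⁽⁰⁾_{j+1,j}).» PROOF (p0012
L80–L120): «the cycle flow is bounded both above and below since the flow F_{j,j+1} along each edge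
cannot exceed in absolute value the capacity … f^min_c < f_c < f^max_c … f_c cannot be equal to
f^max_c or f^min_c, because otherwise one edge would be fully loaded with cos(θᵢ − θⱼ) = 0 …
all fixed points have to satisfy the geometric condition ϖ(f_c) ∈ ℤ. Since we restrict ourselves to
normal operation, the winding number for a single cycle reads ϖ(f_c) = (1/2π)Σⱼ arcsin((F⁽⁰⁾ + f_c)/K)
… the arcsin is a monotonically increasing function … ϖ(f^min_c) ≤ ϖ ≤ ϖ(f^max_c). As the winding
numbers are unique …, the distinct fixed points correspond to the following values of the winding
number: ϖ(f^min_c) + 1, …, ϖ(f^max_c) − 1.» §3 **Cor. 1** (p0004 L68–L77): normal operation on a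
connected network ⇒ stable. §5.4 (p0012 L25–L33): «These states correspond to the normal operation
of a power grid and are guaranteed to be stable by corollary 1».

CONVENTIONS. Ring of `N = n + 1 ≥ 3` machines, `ρ = finRotate (n+1)` the cyclic successor; the
coupling of `S` is the ring with capacity `Kₖ > 0` on the edge `(k, ρk)`:
`S.C i j = if j = ρ i then Kᵢ else if i = ρ j then Kⱼ else 0` (hypothesis `hC`). Edge flow
`Fₖ(θ) = Kₖ sin(θₖ − θ_{ρk})` (from `k` to `ρk`), so the nodal flow is `Fₖ − F_{ρ⁻¹k}`; a REFERENCE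
FLOW is any `F⁰` with `P̃ₖ = F⁰ₖ − F⁰_{ρ⁻¹k}` (hypothesis `hF`; `P̃ₖ = Pₖ − Dₖ·ω_s` the co-rotating
injections). Synchronous state: `P̃ₖ = flowₖ(θ)` (the tree's `stable_syncSolution_of_normalOperation`
shape); normal operation: `cos(θₖ − θ_{ρk}) > 0` on every ring edge; the states are counted as their
representatives pinned at machine `0` in the half-open period box `[−π, π)ᴺ` (one per torus point
modulo rotation, the tree's convention). Winding sum `W(f) = Σₖ arcsin((F⁰ₖ + f)/Kₖ) = 2π·ϖ(f)`.

## What is proved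

* §1 `loadedRing_flow_eq`, `loadedRing_flow_eq_edgeFlow_sub` (nodal flow = `Fₖ − F_{ρ⁻¹k}`),
  **`loadedRing_edgeFlow_eq`** (Kirchhoff on the cycle: at a synchronous state `F(θ) = F⁰ + f_c` with
  ONE cycle flow `f_c = K₀ sin(θ₀ − θ_{ρ0}) − F⁰₀`).
* §2 `loadedRing_edge_abs_lt` (normal operation ⇒ `|F⁰ₖ + f_c| < Kₖ`: «f_c cannot be equal to
  f^max_c or f^min_c»), **`loadedRing_exists_winding`** (normal operation ⇒ every edge angle is
  `arcsin((F⁰ₖ + f_c)/Kₖ)` modulo `2π` and `W(f_c) ∈ 2πℤ`: «ϖ(f_c) ∈ ℤ»), `windingSum_lt`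
  («the arcsin is a monotonically increasing function», strictly on the admissible flows),
  `windingSum_le`, `continuous_windingSum`.
* §3 THE BIJECTION **`loadedRing_ncard_syncStates_eq`**: the pinned normal-operation synchronous
  states of the box are equinumerous with the integers `q` attained as `W(f) = 2πq` by an admissible
  cycle flow (`|F⁰ₖ + f| < Kₖ ∀k`) — «As the winding numbers are unique, the distinct fixed points
  correspond to the values of the winding number» (injective: equal winding number ⇒ equal cycle
  flow ⇒ equal state; surjective: the explicit state `θₖ = −Σ_{i<k} arcsin((F⁰ᵢ + f)/Kᵢ) mod 2π`).
* §4 THE WINDOW `windingIntegers_eq` (IVT + strict monotonicity: the attained integers are exactly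
  those with `W(f_min) < 2πq < W(f_max)`, `f_max = minₖ(Kₖ − F⁰ₖ)`, `f_min = maxₖ(−Kₖ − F⁰ₖ)`),
  `ncard_windingIntegers` (their number is `⌈W(f_max)/2π⌉ − ⌊W(f_min)/2π⌋ − 1`), and
  ★ **`loadedRing_census`** — THEOREM 12 AS PRINTED:
  `#{pinned normal-operation synchronous states} = (⌈ϖ(f_max)⌉ − ⌊ϖ(f_min)⌋ − 1).toNat`.
* §5 ★★ **`loadedRing_normalOperation_census`**: the count AND, by Cor. 1 (`NormalOperationStability`,
  energy route, census-free), every one of these states is a STABLE synchronous state of `S`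
  (`loadedRing_couplingConnected`: a ring of positive capacities is connected;
  `loadedRing_normalOperation_stable`).

* §6 (APPENDED) `loadedRing_syncStates_finite` — the pinned normal-operation synchronous states of
  the box form a FINITE set (they inject, by the winding number of their cycle flow, into a finite
  integer window), so every `Set.ncard` statement of this file and of `LoadedRingCensusBounds` is an
  honest count (referee request #172/#173/#174 r1).

DEVIATIONS FROM THE PRINTED PROOF. None in substance; two points made explicit: (i) MTW count
fixed points modulo the global rotation — here as pinned box representatives; (ii) the printed
«uniqueness of winding numbers» (their Lemma for planar graphs) is proved directly on the cycle:
equal winding number ⇒ equal cycle flow (strict monotonicity of `W` on the admissible interval) ⇒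
equal edge angles modulo `2π` ⇒ equal pinned box state. The `toNat` only matters when no
normal-operation state exists (then both sides are `0`; the printed formula presupposes one).

THREE COLUMNS (LADDER-GRIDFUSION honest framing). CERTIFIED for MODEL `M` = damped lossless
network-reduced swing model whose coupling graph is a ring with arbitrary positive capacities and
arbitrary injections (MODEL-VALIDITY MV-1 class, an idealised single-loop network): the exact number
of normal-operation synchronous states per period as the printed ceiling/floor expression in any
reference flow, and the stability of each. NOT CLAIMED: states outside normal operation; basins;
which physical networks are rings; anything about a power system.
-/

noncomputable section

open Real Set Filter Topology Metric Finset

namespace Literature.MathematicalPhysics.PowerSystems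

namespace ClassicalModel

section LoadedRing

variable {n : ℕ} (S : LosslessSystem (n + 1) 0) (Kv : Fin (n + 1) → ℝ)

/-! ### §0. Walking around the cycle (plumbing) -/

/-- On a ring of at least three machines the two neighbours `ρ k` and `ρ⁻¹ k` of a node are
different (the same fact is private in `RingMultistability` / `RingNormalOperationCensus`).
[folklore] -/
private theorem rotate_ne_rotate_symm₃ (hn : 2 ≤ n) (k : Fin (n + 1)) :
    finRotate (n + 1) k ≠ (finRotate (n + 1)).symm k := by
  intro h
  set j := (finRotate (n + 1)).symm k with hj
  have hk : finRotate (n + 1) j = k := by simp [hj]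
  have h2 : finRotate (n + 1) (finRotate (n + 1) j) = j := by rw [hk]; exact h
  have hv1 : (finRotate (n + 1) j).val = if j = Fin.last n then 0 else j.val + 1 := coe_finRotate j
  have hv2 : (finRotate (n + 1) (finRotate (n + 1) j)).val
      = if finRotate (n + 1) j = Fin.last n then 0 else (finRotate (n + 1) j).val + 1 :=
    coe_finRotate _
  rw [h2] at hv2
  have hjlt : j.val < n + 1 := j.isLt
  by_cases hl : j = Fin.last n
  · have hjn : j.val = n := by rw [hl, Fin.val_last]
    rw [if_pos hl] at hv1
    have hne : finRotate (n + 1) j ≠ Fin.last n := by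
      intro h'
      have h'' := congrArg Fin.val h'
      rw [hv1, Fin.val_last] at h''
      omega
    rw [if_neg hne, hv1] at hv2
    omega
  · rw [if_neg hl] at hv1
    have hjn : j.val ≠ n := fun h' => hl (Fin.ext (by rw [h', Fin.val_last]))
    by_cases hl2 : finRotate (n + 1) j = Fin.last n
    · have h'' := congrArg Fin.val hl2
      rw [hv1, Fin.val_last] at h''
      rw [if_pos hl2] at hv2
      omega
    · rw [if_neg hl2, hv1] at hv2
      omega

/-- Walking `k` steps from machine `0` along the cycle reaches machine `k`. [folklore] -/
private theorem iterate_finRotate_apply_zero (k : Fin (n + 1)) :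
    (finRotate (n + 1))^[k.val] 0 = k := by
  have e : (finRotate (n + 1))^[(k - 0).val] 0 = k := by
    rw [← finCycle_eq_finRotate_iterate, finCycle_apply, add_sub_cancel]
  rwa [sub_zero] at e

/-- A quantity invariant under the cyclic shift is constant on the ring. [folklore] -/
private theorem ring_walk_eq {α : Type*} {g : Fin (n + 1) → α}
    (h : ∀ k, g (finRotate (n + 1) k) = g k) : ∀ j, g j = g 0 := by
  have hiter : ∀ i : ℕ, g ((finRotate (n + 1))^[i] 0) = g 0 := by
    intro i
    induction i with
    | zero => simp
    | succ i ih => rw [Function.iterate_succ_apply', h, ih]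
  intro j
  have h1 := hiter j.val
  rwa [iterate_finRotate_apply_zero] at h1

/-- A quantity invariant under the cyclic shift MODULO `2π` is constant modulo `2π` on the ring.
[folklore] -/
private theorem ring_walk_int {g : Fin (n + 1) → ℝ}
    (h : ∀ k, ∃ m : ℤ, g (finRotate (n + 1) k) = g k + m * (2 * π)) :
    ∀ j, ∃ m : ℤ, g j = g 0 + m * (2 * π) := by
  have hiter : ∀ i : ℕ, ∃ m : ℤ, g ((finRotate (n + 1))^[i] 0) = g 0 + m * (2 * π) := by
    intro i
    induction i with
    | zero => exact ⟨0, by simp⟩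
    | succ i ih =>
      obtain ⟨m, hm⟩ := ih
      obtain ⟨m', hm'⟩ := h ((finRotate (n + 1))^[i] 0)
      exact ⟨m + m', by rw [Function.iterate_succ_apply', hm', hm]; push_cast; ring⟩
  intro j
  obtain ⟨m, hm⟩ := hiter j.val
  rw [iterate_finRotate_apply_zero] at hm
  exact ⟨m, hm⟩

/-! ### §1. The nodal flow of a ring and Kirchhoff's law on the cycle -/

/-- **The nodal flow of a ring at ANY angle vector** (at least three machines, capacities `Kₖ` on
the edges `(k, ρk)`): `flowₖ(θ) = Kₖ sin(θₖ − θ_{ρk}) + K_{ρ⁻¹k} sin(θₖ − θ_{ρ⁻¹k})`.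
[cite: ManikTimmeWitthaut2017, §5.4 («We label the nodes as 1,2,…,N along the cycle …») and §2 (dynamic condition)] -/
theorem loadedRing_flow_eq (hn : 2 ≤ n)
    (hC : ∀ i j, S.C i j = if j = finRotate (n + 1) i then Kv i
      else if i = finRotate (n + 1) j then Kv j else 0)
    (θ : Fin (n + 1) → ℝ) (k : Fin (n + 1)) :
    S.flow θ k = Kv k * Real.sin (θ k - θ (finRotate (n + 1) k))
      + Kv ((finRotate (n + 1)).symm k) * Real.sin (θ k - θ ((finRotate (n + 1)).symm k)) := by
  have hab : finRotate (n + 1) k ≠ (finRotate (n + 1)).symm k := rotate_ne_rotate_symm₃ hn k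
  have hflow : S.flow θ k = ∑ j, S.C k j * Real.sin (θ k - θ j) := by
    simp [LosslessSystem.flow]
  have hrow : ∀ j, S.C k j = (if j = finRotate (n + 1) k then Kv k else 0)
      + (if j = (finRotate (n + 1)).symm k then Kv j else 0) := by
    intro j
    rw [hC]
    have hiff : (k = finRotate (n + 1) j) ↔ (j = (finRotate (n + 1)).symm k) := by
      rw [Equiv.eq_symm_apply]
      exact eq_comm
    by_cases h1 : j = finRotate (n + 1) k
    · have h2 : j ≠ (finRotate (n + 1)).symm k := fun h => hab (h1.symm.trans h)
      rw [if_pos h1, if_pos h1, if_neg h2, add_zero]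
    · rw [if_neg h1, if_neg h1, zero_add]
      by_cases h2 : j = (finRotate (n + 1)).symm k
      · rw [if_pos (hiff.2 h2), if_pos h2]
      · rw [if_neg (fun h => h2 (hiff.1 h)), if_neg h2]
  rw [hflow]
  simp only [hrow, add_mul, Finset.sum_add_distrib, ite_mul, zero_mul, Finset.sum_ite_eq',
    Finset.mem_univ, if_true]

/-- The nodal flow of a ring is the edge flow leaving the node minus the edge flow entering it:
`flowₖ(θ) = Fₖ(θ) − F_{ρ⁻¹k}(θ)`, `Fₖ(θ) = Kₖ sin(θₖ − θ_{ρk})`.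
[cite: ManikTimmeWitthaut2017, §2 (flows F_ij = K_ij sin(θ_i − θ_j) and the dynamic condition Σ_j F_ij = P_i)] -/
theorem loadedRing_flow_eq_edgeFlow_sub (hn : 2 ≤ n)
    (hC : ∀ i j, S.C i j = if j = finRotate (n + 1) i then Kv i
      else if i = finRotate (n + 1) j then Kv j else 0)
    (θ : Fin (n + 1) → ℝ) (k : Fin (n + 1)) :
    S.flow θ k = Kv k * Real.sin (θ k - θ (finRotate (n + 1) k))
      - Kv ((finRotate (n + 1)).symm k) * Real.sin (θ ((finRotate (n + 1)).symm k)
          - θ (finRotate (n + 1) ((finRotate (n + 1)).symm k))) := by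
  rw [loadedRing_flow_eq S Kv hn hC θ k, Equiv.apply_symm_apply]
  have hs : Real.sin (θ k - θ ((finRotate (n + 1)).symm k))
      = -Real.sin (θ ((finRotate (n + 1)).symm k) - θ k) := by
    rw [← Real.sin_neg, neg_sub]
  rw [hs]
  ring

/-- **Kirchhoff on the cycle: at a synchronous state ALL edge flows differ from the reference flow
by ONE cycle flow** — if `P̃ₖ = F⁰ₖ − F⁰_{ρ⁻¹k}` and `P̃ₖ = flowₖ(θ)` at every node, then
`Kₖ sin(θₖ − θ_{ρk}) = F⁰ₖ + f_c` for every edge, with `f_c = K₀ sin(θ₀ − θ_{ρ0}) − F⁰₀`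
(«Suppose we have one fixed point θ₀ with the flows F⁽⁰⁾ and analyze which cycle flow values f_c
lead to different valid fixed points»: all flows are `F⁽⁰⁾ + f_c`).
[cite: ManikTimmeWitthaut2017, §5.4 proof of Thm 12 and §4 (cycle flows)] -/
theorem loadedRing_edgeFlow_eq (hn : 2 ≤ n)
    (hC : ∀ i j, S.C i j = if j = finRotate (n + 1) i then Kv i
      else if i = finRotate (n + 1) j then Kv j else 0)
    {F₀ : Fin (n + 1) → ℝ}
    (hF : ∀ k, S.P k - S.D k * ((∑ j, S.P j) / ∑ j, S.D j)
      = F₀ k - F₀ ((finRotate (n + 1)).symm k))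
    {θ : Fin (n + 1) → ℝ}
    (he : ∀ k, S.P k - S.D k * ((∑ j, S.P j) / ∑ j, S.D j) = S.flow θ k) :
    ∀ k, Kv k * Real.sin (θ k - θ (finRotate (n + 1) k))
      = F₀ k + (Kv 0 * Real.sin (θ 0 - θ (finRotate (n + 1) 0)) - F₀ 0) := by
  have hstep : ∀ j, Kv (finRotate (n + 1) j) * Real.sin (θ (finRotate (n + 1) j)
      - θ (finRotate (n + 1) (finRotate (n + 1) j))) - F₀ (finRotate (n + 1) j)
      = Kv j * Real.sin (θ j - θ (finRotate (n + 1) j)) - F₀ j := by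
    intro j
    have h1 := he (finRotate (n + 1) j)
    rw [hF, loadedRing_flow_eq_edgeFlow_sub S Kv hn hC θ, Equiv.symm_apply_apply] at h1
    linarith
  intro k
  have h := ring_walk_eq
    (g := fun k => Kv k * Real.sin (θ k - θ (finRotate (n + 1) k)) - F₀ k) hstep k
  linarith

/-! ### §2. Normal operation: admissible cycle flows, edge angles by `arcsin`, the winding number -/

/-- **In normal operation no edge is fully loaded**: `cos(θₖ − θ_{ρk}) > 0` and
`Kₖ sin(θₖ − θ_{ρk}) = F⁰ₖ + f` give `|F⁰ₖ + f| < Kₖ` («f_c cannot be equal to f^max_c or f^min_c,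
because otherwise one edge would be fully loaded with cos(θᵢ − θⱼ) = 0»).
[cite: ManikTimmeWitthaut2017, §5.4 proof of Thm 12 (eq. fp_limits)] -/
theorem loadedRing_edge_abs_lt (hK : ∀ k, 0 < Kv k) {θ F₀ : Fin (n + 1) → ℝ} {f : ℝ}
    (hf : ∀ k, Kv k * Real.sin (θ k - θ (finRotate (n + 1) k)) = F₀ k + f)
    (hno : ∀ k, 0 < Real.cos (θ k - θ (finRotate (n + 1) k))) :
    ∀ k, |F₀ k + f| < Kv k := by
  intro k
  have h1 := Real.sin_sq_add_cos_sq (θ k - θ (finRotate (n + 1) k))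
  have hKk := hK k
  have h3 : 0 < Kv k ^ 2 * Real.cos (θ k - θ (finRotate (n + 1) k)) ^ 2 := by
    have := hno k
    positivity
  refine abs_lt_of_sq_lt_sq ?_ hKk.le
  rw [← hf k, mul_pow]
  nlinarith

/-- The admissible edge ratios lie in `[−1, 1]` (closed form, for monotonicity at the endpoints).
[folklore] -/
private theorem ratio_mem_Icc (hK : ∀ k, 0 < Kv k) {F₀ : Fin (n + 1) → ℝ} {f : ℝ}
    (hf : ∀ k, |F₀ k + f| ≤ Kv k) (k : Fin (n + 1)) :
    (F₀ k + f) / Kv k ∈ Set.Icc (-1 : ℝ) 1 := by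
  have h := abs_le.1 (hf k)
  constructor
  · rw [le_div_iff₀ (hK k)]; linarith
  · rw [div_le_iff₀ (hK k)]; linarith

/-- **The winding number of a normal-operation synchronous state**: with the cycle flow `f` of
`loadedRing_edgeFlow_eq` and positive cosines, every edge angle is
`θₖ − θ_{ρk} = arcsin((F⁰ₖ + f)/Kₖ) + 2πmₖ`, and summing around the cycle
`W(f) = Σₖ arcsin((F⁰ₖ + f)/Kₖ) = 2πq` for an INTEGER `q` («all fixed points have to satisfy the
geometric condition ϖ(f_c) ∈ ℤ … in normal operation ϖ(f_c) = (1/2π)Σⱼ arcsin((F⁽⁰⁾ + f_c)/K)»).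
[cite: ManikTimmeWitthaut2017, §5.4 proof of Thm 12; §3.2 (winding number)] -/
theorem loadedRing_exists_winding (hK : ∀ k, 0 < Kv k) {θ F₀ : Fin (n + 1) → ℝ} {f : ℝ}
    (hf : ∀ k, Kv k * Real.sin (θ k - θ (finRotate (n + 1) k)) = F₀ k + f)
    (hno : ∀ k, 0 < Real.cos (θ k - θ (finRotate (n + 1) k))) :
    ∃ q : ℤ, (∑ k, Real.arcsin ((F₀ k + f) / Kv k)) = 2 * π * q ∧
      ∀ k, ∃ m : ℤ, θ k - θ (finRotate (n + 1) k)
        = Real.arcsin ((F₀ k + f) / Kv k) + m * (2 * π) := by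
  have hx : ∀ k, |(F₀ k + f) / Kv k| < 1 := fun k => by
    rw [abs_div, abs_of_pos (hK k), div_lt_one (hK k)]
    exact loadedRing_edge_abs_lt Kv hK hf hno k
  have hedge : ∀ k, ∃ m : ℤ, θ k - θ (finRotate (n + 1) k)
      = Real.arcsin ((F₀ k + f) / Kv k) + m * (2 * π) := by
    intro k
    have h1 := abs_lt.1 (hx k)
    have h2 : ((F₀ k + f) / Kv k) ^ 2 < 1 := (sq_lt_one_iff_abs_lt_one _).2 (hx k)
    refine exists_eq_add_int_mul_two_pi_of_sin_eq_of_cos_pos ?_ (hno k) ?_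
    · rw [Real.sin_arcsin h1.1.le h1.2.le, eq_div_iff (hK k).ne', mul_comm]
      exact hf k
    · rw [Real.cos_arcsin]
      exact Real.sqrt_pos.2 (by linarith)
  choose m hm using hedge
  refine ⟨-∑ k, m k, ?_, fun k => ⟨m k, hm k⟩⟩
  have hsum0 : ∑ k, (θ k - θ (finRotate (n + 1) k)) = 0 := by
    rw [Finset.sum_sub_distrib, Equiv.sum_comp (finRotate (n + 1)) θ, sub_self]
  have h1 : ∑ k, (θ k - θ (finRotate (n + 1) k))
      = ∑ k, (Real.arcsin ((F₀ k + f) / Kv k) + (m k : ℝ) * (2 * π)) :=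
    Finset.sum_congr rfl fun k _ => hm k
  rw [hsum0, Finset.sum_add_distrib, ← Finset.sum_mul] at h1
  push_cast
  linarith

/-- **«The arcsin is a monotonically increasing function»** — STRICTLY on the admissible flows:
for `f < g` with `|F⁰ₖ + f| ≤ Kₖ`, `|F⁰ₖ + g| ≤ Kₖ` the winding sum strictly increases,
`W(f) < W(g)` (`N ≥ 1` terms, each strictly increasing on `[−1, 1]`).
[cite: ManikTimmeWitthaut2017, §5.4 proof of Thm 12] -/
theorem windingSum_lt (hK : ∀ k, 0 < Kv k) {F₀ : Fin (n + 1) → ℝ} {f g : ℝ} (hfg : f < g)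
    (hf : ∀ k, |F₀ k + f| ≤ Kv k) (hg : ∀ k, |F₀ k + g| ≤ Kv k) :
    ∑ k, Real.arcsin ((F₀ k + f) / Kv k) < ∑ k, Real.arcsin ((F₀ k + g) / Kv k) := by
  apply Finset.sum_lt_sum_of_nonempty Finset.univ_nonempty
  intro k _
  exact Real.strictMonoOn_arcsin (ratio_mem_Icc Kv hK hf k) (ratio_mem_Icc Kv hK hg k)
    ((div_lt_div_iff_of_pos_right (hK k)).2 (by linarith))

/-- The winding sum is monotone in the cycle flow (on all of `ℝ`, `arcsin` being monotone).
[cite: ManikTimmeWitthaut2017, §5.4 proof of Thm 12] -/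
theorem windingSum_le (hK : ∀ k, 0 < Kv k) (F₀ : Fin (n + 1) → ℝ) {f g : ℝ} (hfg : f ≤ g) :
    ∑ k, Real.arcsin ((F₀ k + f) / Kv k) ≤ ∑ k, Real.arcsin ((F₀ k + g) / Kv k) := by
  apply Finset.sum_le_sum
  intro k _
  exact Real.monotone_arcsin (div_le_div_of_nonneg_right (by linarith) (hK k).le)

/-- The winding sum is continuous in the cycle flow (used for the intermediate values between
`ϖ(f^min_c)` and `ϖ(f^max_c)`). [folklore] [cite: ManikTimmeWitthaut2017, §5.4 proof of Thm 12 («ϖ(f^min_c) ≤ ϖ ≤ ϖ(f^max_c)» and the list of attained values)] -/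
theorem continuous_windingSum (F₀ : Fin (n + 1) → ℝ) :
    Continuous fun f : ℝ => ∑ k, Real.arcsin ((F₀ k + f) / Kv k) := by
  refine continuous_finsetSum _ fun k _ => ?_
  exact Real.continuous_arcsin.comp ((continuous_const.add continuous_id).div_const _)

/-! ### §3. THE BIJECTION: pinned normal-operation synchronous states ↔ attained winding numbers -/

/-- The candidate angle vector `ψₖ = −Σ_{i<k} aᵢ` starts at `ψ₀ = 0`. [folklore] -/
private theorem psi_zero {a ψ : Fin (n + 1) → ℝ}
    (hψ : ∀ j, ψ j = -∑ i, (if i.val < j.val then a i else 0)) : ψ 0 = 0 := by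
  rw [hψ]
  simp

/-- … and steps down by `aₖ` along every edge but the closing one. [folklore] -/
private theorem psi_rotate_of_ne_last {a ψ : Fin (n + 1) → ℝ}
    (hψ : ∀ j, ψ j = -∑ i, (if i.val < j.val then a i else 0)) (k : Fin (n + 1))
    (hk : k ≠ Fin.last n) : ψ (finRotate (n + 1) k) = ψ k - a k := by
  rw [hψ, hψ]
  have hv : (finRotate (n + 1) k).val = k.val + 1 := coe_finRotate_of_ne_last hk
  have hpt : ∀ i : Fin (n + 1), (if i.val < (finRotate (n + 1) k).val then a i else 0)
      = (if i.val < k.val then a i else 0) + (if i = k then a i else 0) := by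
    intro i
    rw [hv]
    by_cases h1 : i.val < k.val
    · have h2 : i ≠ k := fun h => by rw [h] at h1; exact lt_irrefl _ h1
      rw [if_pos (by omega), if_pos h1, if_neg h2, add_zero]
    · by_cases h2 : i = k
      · rw [if_pos (by rw [h2]; omega), if_neg h1, if_pos h2, zero_add]
      · have h3 : i.val ≠ k.val := fun h => h2 (Fin.ext h)
        rw [if_neg (by omega), if_neg h1, if_neg h2, add_zero]
  simp only [hpt, Finset.sum_add_distrib, Finset.sum_ite_eq', Finset.mem_univ, if_true]
  ring

/-- … while on the closing edge `(last, 0)` it jumps by `a_last − Σᵢ aᵢ`. [folklore] -/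
private theorem psi_last {a ψ : Fin (n + 1) → ℝ}
    (hψ : ∀ j, ψ j = -∑ i, (if i.val < j.val then a i else 0)) :
    ψ (Fin.last n) = -(∑ i, a i) + a (Fin.last n) := by
  rw [hψ]
  have hpt : ∀ i : Fin (n + 1), a i
      = (if i.val < (Fin.last n).val then a i else 0) + (if i = Fin.last n then a i else 0) := by
    intro i
    rw [Fin.val_last]
    by_cases h1 : i = Fin.last n
    · have h2 : ¬ i.val < n := by rw [h1, Fin.val_last]; omega
      rw [if_neg h2, if_pos h1, zero_add]
    · have h2 : i.val < n := by
        have h3 : i.val ≠ n := fun h => h1 (Fin.ext (by rw [h, Fin.val_last]))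
        have := i.isLt
        omega
      rw [if_pos h2, if_neg h1, add_zero]
  have hsum : ∑ i, a i = ∑ i, (if i.val < (Fin.last n).val then a i else 0) + a (Fin.last n) := by
    conv_lhs => rw [Finset.sum_congr rfl fun i _ => hpt i]
    rw [Finset.sum_add_distrib, Finset.sum_ite_eq' Finset.univ (Fin.last n) a,
      if_pos (Finset.mem_univ _)]
  linarith

/-- **Every edge angle of the candidate is `aₖ` modulo `2π`**, provided the winding condition
`Σᵢ aᵢ = 2πq` holds (the closing edge absorbs the `q` turns). [cite: ManikTimmeWitthaut2017, §3.2 (geometric condition ϖ ∈ ℤ) and §5.4] -/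
private theorem psi_edge {a ψ : Fin (n + 1) → ℝ}
    (hψ : ∀ j, ψ j = -∑ i, (if i.val < j.val then a i else 0)) {q : ℤ}
    (hW : ∑ i, a i = 2 * π * q) :
    ∀ k, ∃ m : ℤ, ψ k - ψ (finRotate (n + 1) k) = a k + m * (2 * π) := by
  intro k
  by_cases hk : k = Fin.last n
  · refine ⟨-q, ?_⟩
    rw [hk, finRotate_last, psi_zero hψ, psi_last hψ, hW]
    push_cast
    ring
  · exact ⟨0, by rw [psi_rotate_of_ne_last hψ k hk]; push_cast; ring⟩

/-- The box representative `θₖ = ψₖ mod 2π ∈ [−π, π)` keeps the edge angles modulo `2π`.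
[folklore] -/
private theorem box_edge {a ψ : Fin (n + 1) → ℝ}
    (hψ : ∀ j, ψ j = -∑ i, (if i.val < j.val then a i else 0)) {q : ℤ}
    (hW : ∑ i, a i = 2 * π * q) :
    ∀ k, ∃ m : ℤ, toIcoMod Real.two_pi_pos (-π) (ψ k)
        - toIcoMod Real.two_pi_pos (-π) (ψ (finRotate (n + 1) k)) = a k + m * (2 * π) := by
  intro k
  obtain ⟨m, hm⟩ := psi_edge hψ hW k
  have h1 := toIcoMod_add_toIcoDiv_zsmul Real.two_pi_pos (-π) (ψ k)
  have h2 := toIcoMod_add_toIcoDiv_zsmul Real.two_pi_pos (-π) (ψ (finRotate (n + 1) k))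
  rw [zsmul_eq_mul] at h1 h2
  refine ⟨m - toIcoDiv Real.two_pi_pos (-π) (ψ k)
    + toIcoDiv Real.two_pi_pos (-π) (ψ (finRotate (n + 1) k)), ?_⟩
  push_cast
  linarith

/-- Two angle vectors of the period box pinned at machine `0` with the same edge angles modulo
`2π` are EQUAL. [folklore] [cite: ManikTimmeWitthaut2017, §5.4 («As the winding numbers are unique …»)] -/
private theorem eq_of_edges_congr {θ θ' : Fin (n + 1) → ℝ} (h0 : θ 0 = 0) (h0' : θ' 0 = 0)
    (hbox : ∀ i, θ i ∈ Set.Ico (-π) π) (hbox' : ∀ i, θ' i ∈ Set.Ico (-π) π)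
    (hedge : ∀ k, ∃ m : ℤ, (θ k - θ (finRotate (n + 1) k))
      = (θ' k - θ' (finRotate (n + 1) k)) + m * (2 * π)) : θ = θ' := by
  have hwalk : ∀ k, ∃ m : ℤ, (θ (finRotate (n + 1) k) - θ' (finRotate (n + 1) k))
      = (θ k - θ' k) + m * (2 * π) := by
    intro k
    obtain ⟨m, hm⟩ := hedge k
    exact ⟨-m, by push_cast; linarith⟩
  funext j
  obtain ⟨m, hm⟩ := ring_walk_int (g := fun k => θ k - θ' k) hwalk j
  simp only [h0, h0', sub_zero, zero_add] at hm
  have hj : θ j = θ' j + m • (2 * π) := by rw [zsmul_eq_mul]; linarith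
  have hIco : ∀ x : ℝ, x ∈ Set.Ico (-π) π → toIcoMod Real.two_pi_pos (-π) x = x := by
    intro x hx
    rw [toIcoMod_eq_self, show -π + 2 * π = π by ring]
    exact hx
  rw [← hIco (θ j) (hbox j), ← hIco (θ' j) (hbox' j), hj, toIcoMod_add_zsmul]

/-- ★ **THE BIJECTION (ring `N = n + 1 ≥ 3`, capacities `Kₖ > 0`, any reference flow `F⁰`): the
pinned normal-operation synchronous states of the period box are EQUINUMEROUS with the winding
numbers attained by admissible cycle flows** — the integers `q` with
`Σₖ arcsin((F⁰ₖ + f)/Kₖ) = 2πq` for some `f` with `|F⁰ₖ + f| < Kₖ` for all `k`. Injective: equal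
winding number ⇒ equal cycle flow (strict monotonicity of `W`) ⇒ equal edge angles mod `2π` ⇒ equal
pinned box state («As the winding numbers are unique, the distinct fixed points correspond to the
values of the winding number»); surjective: `θₖ = −Σ_{i<k} arcsin((F⁰ᵢ + f)/Kᵢ) mod 2π` is a pinned
normal-operation synchronous state with winding number `q`.
[cite: ManikTimmeWitthaut2017, §5.4 Thm 12 and its proof; §4 Thm (fixed points ↔ winding numbers)] -/
theorem loadedRing_ncard_syncStates_eq (hn : 2 ≤ n) (hK : ∀ k, 0 < Kv k)
    (hC : ∀ i j, S.C i j = if j = finRotate (n + 1) i then Kv i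
      else if i = finRotate (n + 1) j then Kv j else 0)
    {F₀ : Fin (n + 1) → ℝ}
    (hF : ∀ k, S.P k - S.D k * ((∑ j, S.P j) / ∑ j, S.D j)
      = F₀ k - F₀ ((finRotate (n + 1)).symm k)) :
    {θ : Fin (n + 1) → ℝ | θ 0 = 0 ∧ (∀ i, θ i ∈ Set.Ico (-π) π) ∧
        (∀ k, S.P k - S.D k * ((∑ j, S.P j) / ∑ j, S.D j) = S.flow θ k) ∧
        ∀ k, 0 < Real.cos (θ k - θ (finRotate (n + 1) k))}.ncard
      = {q : ℤ | ∃ f : ℝ, (∀ k, |F₀ k + f| < Kv k) ∧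
          ∑ k, Real.arcsin ((F₀ k + f) / Kv k) = 2 * π * q}.ncard := by
  have hπ := Real.pi_pos
  have h2π : (0 : ℝ) < 2 * π := by positivity
  -- the cycle flow, the winding number and the floor map of a state
  -- (A) every state: its cycle flow `fθ` is admissible and `W fθ = 2π qθ`, `qθ ∈ ℤ`
  have hA : ∀ θ : Fin (n + 1) → ℝ,
      (∀ k, S.P k - S.D k * ((∑ j, S.P j) / ∑ j, S.D j) = S.flow θ k) →
      (∀ k, 0 < Real.cos (θ k - θ (finRotate (n + 1) k))) →
      (∀ k, Kv k * Real.sin (θ k - θ (finRotate (n + 1) k))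
          = F₀ k + (Kv 0 * Real.sin (θ 0 - θ (finRotate (n + 1) 0)) - F₀ 0)) ∧
      (∀ k, |F₀ k + (Kv 0 * Real.sin (θ 0 - θ (finRotate (n + 1) 0)) - F₀ 0)| < Kv k) ∧
      ∃ q : ℤ, (∑ k, Real.arcsin ((F₀ k
          + (Kv 0 * Real.sin (θ 0 - θ (finRotate (n + 1) 0)) - F₀ 0)) / Kv k)) = 2 * π * q ∧
        (⌊(∑ k, Real.arcsin ((F₀ k
          + (Kv 0 * Real.sin (θ 0 - θ (finRotate (n + 1) 0)) - F₀ 0)) / Kv k)) / (2 * π)⌋ = q) ∧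
        ∀ k, ∃ m : ℤ, θ k - θ (finRotate (n + 1) k)
          = Real.arcsin ((F₀ k + (Kv 0 * Real.sin (θ 0 - θ (finRotate (n + 1) 0)) - F₀ 0))
              / Kv k) + m * (2 * π) := by
    intro θ he hno
    have hf := loadedRing_edgeFlow_eq S Kv hn hC hF he
    refine ⟨hf, loadedRing_edge_abs_lt Kv hK hf hno, ?_⟩
    obtain ⟨q, hq, hm⟩ := loadedRing_exists_winding Kv hK hf hno
    refine ⟨q, hq, ?_, hm⟩
    rw [hq, show 2 * π * (q : ℝ) / (2 * π) = q by field_simp]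
    exact Int.floor_intCast q
  refine Set.ncard_congr
    (fun θ _ => ⌊(∑ k, Real.arcsin ((F₀ k
        + (Kv 0 * Real.sin (θ 0 - θ (finRotate (n + 1) 0)) - F₀ 0)) / Kv k)) / (2 * π)⌋)
    ?_ ?_ ?_
  · -- (h₁) the winding number of a state is attained by its (admissible) cycle flow
    rintro θ ⟨_, _, he, hno⟩
    obtain ⟨_, hadm, q, hq, hfl, _⟩ := hA θ he hno
    exact ⟨Kv 0 * Real.sin (θ 0 - θ (finRotate (n + 1) 0)) - F₀ 0, hadm, by rw [hfl]; exact hq⟩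
  · -- (h₂) equal winding numbers ⇒ equal cycle flows ⇒ equal states
    rintro θ θ' ⟨h0, hbox, he, hno⟩ ⟨h0', hbox', he', hno'⟩ hqq
    obtain ⟨hf, hadm, q, hq, hfl, hm⟩ := hA θ he hno
    obtain ⟨hf', hadm', q', hq', hfl', hm'⟩ := hA θ' he' hno'
    have hqq' : q = q' := by rw [← hfl, ← hfl']; exact hqq
    set f := Kv 0 * Real.sin (θ 0 - θ (finRotate (n + 1) 0)) - F₀ 0 with hfdef
    set f' := Kv 0 * Real.sin (θ' 0 - θ' (finRotate (n + 1) 0)) - F₀ 0 with hf'def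
    have hW : ∑ k, Real.arcsin ((F₀ k + f) / Kv k) = ∑ k, Real.arcsin ((F₀ k + f') / Kv k) := by
      rw [hq, hq', hqq']
    -- strict monotonicity forces `f = f'`
    have hle : ∀ k, |F₀ k + f| ≤ Kv k := fun k => (hadm k).le
    have hle' : ∀ k, |F₀ k + f'| ≤ Kv k := fun k => (hadm' k).le
    have hff : f = f' := by
      rcases lt_trichotomy f f' with h | h | h
      · exact absurd hW (windingSum_lt Kv hK h hle hle').ne
      · exact h
      · exact absurd hW.symm (windingSum_lt Kv hK h hle' hle).ne
    -- equal edge angles modulo `2π`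
    refine eq_of_edges_congr h0 h0' hbox hbox' fun k => ?_
    obtain ⟨m, hmk⟩ := hm k
    obtain ⟨m', hmk'⟩ := hm' k
    refine ⟨m - m', ?_⟩
    rw [hmk, hmk', hff]
    push_cast
    ring
  · -- (h₃) every attained winding number is the winding number of a state: the explicit candidate
    rintro q ⟨f, hadm, hW⟩
    set a : Fin (n + 1) → ℝ := fun k => Real.arcsin ((F₀ k + f) / Kv k) with ha
    set ψ : Fin (n + 1) → ℝ := fun j => -∑ i, (if i.val < j.val then a i else 0) with hψdef
    have hψ : ∀ j, ψ j = -∑ i, (if i.val < j.val then a i else 0) := fun j => rfl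
    have hW' : ∑ i, a i = 2 * π * q := hW
    set θ : Fin (n + 1) → ℝ := fun j => toIcoMod Real.two_pi_pos (-π) (ψ j) with hθdef
    -- edge angles of the candidate: `aₖ` modulo `2π`
    have hedge : ∀ k, ∃ m : ℤ, θ k - θ (finRotate (n + 1) k) = a k + m * (2 * π) :=
      box_edge hψ hW'
    have hx : ∀ k, |(F₀ k + f) / Kv k| < 1 := fun k => by
      rw [abs_div, abs_of_pos (hK k), div_lt_one (hK k)]
      exact hadm k
    -- hence the edge sines and cosines
    have hsin : ∀ k, Kv k * Real.sin (θ k - θ (finRotate (n + 1) k)) = F₀ k + f := by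
      intro k
      obtain ⟨m, hm⟩ := hedge k
      have h1 := abs_lt.1 (hx k)
      have hKk : Kv k ≠ 0 := (hK k).ne'
      rw [hm, Real.sin_add_int_mul_two_pi, ha]
      simp only
      rw [Real.sin_arcsin h1.1.le h1.2.le]
      field_simp
    have hcos : ∀ k, 0 < Real.cos (θ k - θ (finRotate (n + 1) k)) := by
      intro k
      obtain ⟨m, hm⟩ := hedge k
      have h2 : ((F₀ k + f) / Kv k) ^ 2 < 1 := (sq_lt_one_iff_abs_lt_one _).2 (hx k)
      rw [hm, Real.cos_add_int_mul_two_pi, ha]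
      simp only
      rw [Real.cos_arcsin]
      exact Real.sqrt_pos.2 (by linarith)
    -- the candidate is a pinned normal-operation synchronous state of the box
    have hmem : θ ∈ {θ : Fin (n + 1) → ℝ | θ 0 = 0 ∧ (∀ i, θ i ∈ Set.Ico (-π) π) ∧
        (∀ k, S.P k - S.D k * ((∑ j, S.P j) / ∑ j, S.D j) = S.flow θ k) ∧
        ∀ k, 0 < Real.cos (θ k - θ (finRotate (n + 1) k))} := by
      refine ⟨?_, ?_, ?_, hcos⟩
      · show toIcoMod Real.two_pi_pos (-π) (ψ 0) = 0
        rw [psi_zero hψ, toIcoMod_eq_self]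
        constructor <;> linarith
      · intro i
        have h := toIcoMod_mem_Ico Real.two_pi_pos (-π) (ψ i)
        rwa [show -π + 2 * π = π by ring] at h
      · intro k
        rw [loadedRing_flow_eq_edgeFlow_sub S Kv hn hC θ k, hsin, hsin, hF]
        ring
    -- its cycle flow is `f`, so its winding number is `q`
    have hf0 : Kv 0 * Real.sin (θ 0 - θ (finRotate (n + 1) 0)) - F₀ 0 = f := by
      rw [hsin 0]; ring
    refine ⟨θ, hmem, ?_⟩
    simp only [hf0]
    rw [hW, show 2 * π * (q : ℝ) / (2 * π) = q by field_simp]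
    exact Int.floor_intCast q

/-! ### §4. THE WINDOW of attained winding numbers and THEOREM 12 -/

/-- **The attained winding numbers are exactly the integers strictly between `ϖ(f_min)` and
`ϖ(f_max)`** (`f_max = minₖ(Kₖ − F⁰ₖ)`, `f_min = maxₖ(−Kₖ − F⁰ₖ)`): an admissible cycle flow lies in
`(f_min, f_max)` where `W` is strictly increasing («ϖ(f^min_c) ≤ ϖ ≤ ϖ(f^max_c)», strictly since the
endpoints are not admissible); conversely every value strictly between `W(f_min)` and `W(f_max)` is
attained on `(f_min, f_max)` by the intermediate value theorem.
[cite: ManikTimmeWitthaut2017, §5.4 Thm 12 proof («Using the bound for the cycle flow strength, and the fact that the arcsin is a monotonically increasing function …»)] -/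
theorem windingIntegers_eq (hK : ∀ k, 0 < Kv k) (F₀ : Fin (n + 1) → ℝ) :
    {q : ℤ | ∃ f : ℝ, (∀ k, |F₀ k + f| < Kv k) ∧
        ∑ k, Real.arcsin ((F₀ k + f) / Kv k) = 2 * π * q}
      = {q : ℤ | ∑ k, Real.arcsin ((F₀ k
            + Finset.univ.sup' Finset.univ_nonempty (fun k => -Kv k - F₀ k)) / Kv k) < 2 * π * q ∧
          2 * π * q < ∑ k, Real.arcsin ((F₀ k
            + Finset.univ.inf' Finset.univ_nonempty (fun k => Kv k - F₀ k)) / Kv k)} := by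
  set fmin := Finset.univ.sup' Finset.univ_nonempty (fun k => -Kv k - F₀ k) with hfmin
  set fmax := Finset.univ.inf' Finset.univ_nonempty (fun k => Kv k - F₀ k) with hfmax
  -- admissible ⇔ strictly between `fmin` and `fmax`
  have hadm_iff : ∀ f : ℝ, (∀ k, |F₀ k + f| < Kv k) ↔ fmin < f ∧ f < fmax := by
    intro f
    rw [hfmin, hfmax, Finset.sup'_lt_iff, Finset.lt_inf'_iff]
    constructor
    · intro h
      exact ⟨fun k _ => by have := (abs_lt.1 (h k)).1; linarith,
        fun k _ => by have := (abs_lt.1 (h k)).2; linarith⟩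
    · rintro ⟨h1, h2⟩ k
      have := h1 k (mem_univ _)
      have := h2 k (mem_univ _)
      exact abs_lt.2 ⟨by linarith, by linarith⟩
  -- closed admissibility of the endpoints once `fmin ≤ fmax`
  have hmin_le : ∀ k, -Kv k - F₀ k ≤ fmin := fun k =>
    Finset.le_sup' (fun k => -Kv k - F₀ k) (mem_univ k)
  have hmax_le : ∀ k, fmax ≤ Kv k - F₀ k := fun k =>
    Finset.inf'_le (fun k => Kv k - F₀ k) (mem_univ k)
  have hclosed : ∀ f, fmin ≤ f → f ≤ fmax → ∀ k, |F₀ k + f| ≤ Kv k := by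
    intro f h1 h2 k
    have := hmin_le k
    have := hmax_le k
    exact abs_le.2 ⟨by linarith, by linarith⟩
  ext q
  simp only [Set.mem_setOf_eq]
  constructor
  · rintro ⟨f, hadm, hW⟩
    obtain ⟨h1, h2⟩ := (hadm_iff f).1 hadm
    have hle : ∀ k, |F₀ k + f| ≤ Kv k := fun k => (hadm k).le
    rw [← hW]
    exact ⟨windingSum_lt Kv hK h1 (hclosed fmin le_rfl (by linarith)) hle,
      windingSum_lt Kv hK h2 hle (hclosed fmax (by linarith) le_rfl)⟩
  · rintro ⟨h1, h2⟩
    -- the window is nonempty only if `fmin < fmax`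
    have hlt : fmin < fmax := by
      by_contra h
      push Not at h
      have := windingSum_le Kv hK F₀ h
      linarith
    -- intermediate value theorem on `[fmin, fmax]`
    have hivt := intermediate_value_Icc hlt.le ((continuous_windingSum Kv F₀).continuousOn)
    obtain ⟨f, ⟨hf1, hf2⟩, hWf⟩ := hivt ⟨h1.le, h2.le⟩
    simp only at hWf
    refine ⟨f, (hadm_iff f).2 ⟨lt_of_le_of_ne hf1 ?_, lt_of_le_of_ne hf2 ?_⟩, hWf⟩
    · rintro rfl; linarith
    · rintro rfl; linarith

/-- **Counting the window**: the integers `q` with `b < 2πq < a` number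
`(⌈a/2π⌉ − ⌊b/2π⌋ − 1).toNat` — the printed «⌈…⌉ − ⌊…⌋ − 1».
[cite: ManikTimmeWitthaut2017, §5.4 Thm 12 («Counting these values … yields the number of fixed points 𝒩»)] -/
theorem ncard_windingIntegers (a b : ℝ) :
    {q : ℤ | b < 2 * π * q ∧ 2 * π * q < a}.ncard = (⌈a / (2 * π)⌉ - ⌊b / (2 * π)⌋ - 1).toNat := by
  have h2π : (0 : ℝ) < 2 * π := by positivity
  have hset : {q : ℤ | b < 2 * π * q ∧ 2 * π * q < a}
      = ↑(Finset.Ioo ⌊b / (2 * π)⌋ ⌈a / (2 * π)⌉) := by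
    ext q
    rw [Set.mem_setOf_eq, Finset.coe_Ioo, Set.mem_Ioo, Int.floor_lt, Int.lt_ceil,
      div_lt_iff₀ h2π, lt_div_iff₀ h2π]
    constructor <;> rintro ⟨h1, h2⟩ <;> constructor <;> linarith
  rw [hset, Set.ncard_coe_finset, Int.card_Ioo]

/-- ★ **THEOREM 12 (Manik–Timme–Witthaut) — the number of normal-operation synchronous states of a
loaded ring.** Ring of `N = n + 1 ≥ 3` machines with capacities `Kₖ > 0` on the edges `(k, ρk)`
(`S.C` = the ring, hypothesis `hC`), arbitrary injections, `F⁰` ANY reference flow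
(`P̃ₖ = F⁰ₖ − F⁰_{ρ⁻¹k}`, `P̃ = P − D·ω_s`). Then the synchronous states (`P̃ = flow(θ)`) pinned at
machine `0` with all angles in `[−π, π)` and positive cosine on every ring edge number EXACTLY
`(⌈ϖ(f_max)⌉ − ⌊ϖ(f_min)⌋ − 1).toNat`, `ϖ(f) = (1/2π)Σₖ arcsin((F⁰ₖ + f)/Kₖ)`,
`f_max = minₖ(Kₖ − F⁰ₖ)`, `f_min = maxₖ(−Kₖ − F⁰ₖ)` («𝒩 = ⌈…⌉ − ⌊…⌋ − 1»; the `toNat` is the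
printed number whenever a normal-operation state exists, and `0 = 0` otherwise).
[cite: ManikTimmeWitthaut2017, §5.4 Thm 12 (statement p0012 L60–L78, proof L80–L120)] -/
theorem loadedRing_census (hn : 2 ≤ n) (hK : ∀ k, 0 < Kv k)
    (hC : ∀ i j, S.C i j = if j = finRotate (n + 1) i then Kv i
      else if i = finRotate (n + 1) j then Kv j else 0)
    {F₀ : Fin (n + 1) → ℝ}
    (hF : ∀ k, S.P k - S.D k * ((∑ j, S.P j) / ∑ j, S.D j)
      = F₀ k - F₀ ((finRotate (n + 1)).symm k)) :
    {θ : Fin (n + 1) → ℝ | θ 0 = 0 ∧ (∀ i, θ i ∈ Set.Ico (-π) π) ∧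
        (∀ k, S.P k - S.D k * ((∑ j, S.P j) / ∑ j, S.D j) = S.flow θ k) ∧
        ∀ k, 0 < Real.cos (θ k - θ (finRotate (n + 1) k))}.ncard
      = (⌈(∑ k, Real.arcsin ((F₀ k
            + Finset.univ.inf' Finset.univ_nonempty (fun k => Kv k - F₀ k)) / Kv k)) / (2 * π)⌉
        - ⌊(∑ k, Real.arcsin ((F₀ k
            + Finset.univ.sup' Finset.univ_nonempty (fun k => -Kv k - F₀ k)) / Kv k)) / (2 * π)⌋
        - 1).toNat := by
  rw [loadedRing_ncard_syncStates_eq S Kv hn hK hC hF, windingIntegers_eq Kv hK F₀,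
    ncard_windingIntegers]

/-! ### §5. Cor. 1 on the ring: every one of them is a STABLE synchronous state -/

/-- The ring coupling is symmetric. [cite: ManikTimmeWitthaut2017, §2 (K_ij = K_ji)] -/
theorem loadedRing_C_symm (hn : 2 ≤ n)
    (hC : ∀ i j, S.C i j = if j = finRotate (n + 1) i then Kv i
      else if i = finRotate (n + 1) j then Kv j else 0) :
    ∀ i j, S.C i j = S.C j i := by
  intro i j
  rw [hC i j, hC j i]
  by_cases h1 : j = finRotate (n + 1) i
  · by_cases h2 : i = finRotate (n + 1) j
    · -- both would make `ρ(ρ i) = i`, impossible on a ring of ≥ 3 machines; values agree anyway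
      exfalso
      have h3 : finRotate (n + 1) (finRotate (n + 1) i) = i := by rw [← h1]; exact h2.symm
      have h4 : finRotate (n + 1) i = (finRotate (n + 1)).symm i := by
        rw [Equiv.eq_symm_apply]; exact h3
      exact rotate_ne_rotate_symm₃ hn i h4
    · rw [if_pos h1, if_neg h2, if_pos h1]
  · by_cases h2 : i = finRotate (n + 1) j
    · rw [if_neg h1, if_pos h2, if_pos h2]
    · rw [if_neg h1, if_neg h2, if_neg h2, if_neg h1]

/-- The ring couplings are nonnegative (positive capacities on the ring edges, zero elsewhere).
[folklore] [cite: ManikTimmeWitthaut2017, §2 (coupling matrix K_ij ≥ 0) and §5.4 (ring R_N)] -/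
theorem loadedRing_C_nonneg (hK : ∀ k, 0 < Kv k)
    (hC : ∀ i j, S.C i j = if j = finRotate (n + 1) i then Kv i
      else if i = finRotate (n + 1) j then Kv j else 0) :
    ∀ i j, i ≠ j → 0 ≤ S.C i j := by
  intro i j _
  rw [hC]
  split_ifs
  · exact (hK i).le
  · exact (hK j).le
  · exact le_rfl

/-- **A ring of positive capacities is CONNECTED** (cut form `CouplingConnected`): the path
`0 – 1 – ⋯ – n` is a rooted spanning tree of positive couplings (`parent i = i − 1`,
`ρ(i − 1) = i`). [cite: ManikTimmeWitthaut2017, §3 Cor. 1 («Consider a simply connected network»)] -/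
theorem loadedRing_couplingConnected (hn : 2 ≤ n) (hK : ∀ k, 0 < Kv k)
    (hC : ∀ i j, S.C i j = if j = finRotate (n + 1) i then Kv i
      else if i = finRotate (n + 1) j then Kv j else 0) :
    CouplingConnected S.C := by
  refine couplingConnected_of_rootedTree (root := (0 : Fin (n + 1))) (parent := fun i => i - 1)
    (depth := fun i => i.val) ?_ (loadedRing_C_symm S Kv hn hC) ?_
  · intro i hi
    show i.val = (i - 1).val + 1
    rw [Fin.coe_sub_one, if_neg hi]
    have : i.val ≠ 0 := fun h => hi (Fin.ext h)
    omega
  · intro i _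
    show 0 < S.C i (i - 1)
    rw [hC]
    have h2 : i = finRotate (n + 1) (i - 1) := by rw [finRotate_apply, sub_add_cancel]
    split_ifs with h1
    · exact hK i
    · exact hK (i - 1)

/-- Normal operation on the ring edges in the `(i, j)`-form of `NormalOperationStability`.
[cite: ManikTimmeWitthaut2017, §3 Cor. 1] -/
theorem loadedRing_normalOperation_of_edges (hK : ∀ k, 0 < Kv k)
    (hC : ∀ i j, S.C i j = if j = finRotate (n + 1) i then Kv i
      else if i = finRotate (n + 1) j then Kv j else 0)
    {θ : Fin (n + 1) → ℝ} (hno : ∀ k, 0 < Real.cos (θ k - θ (finRotate (n + 1) k))) :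
    ∀ i j, i ≠ j → 0 < S.C i j → 0 < Real.cos (θ i - θ j) := by
  have _ := hK
  intro i j _ hCij
  rw [hC] at hCij
  by_cases h1 : j = finRotate (n + 1) i
  · rw [h1]; exact hno i
  · rw [if_neg h1] at hCij
    by_cases h2 : i = finRotate (n + 1) j
    · rw [h2, ← Real.cos_neg, neg_sub]; exact hno j
    · rw [if_neg h2] at hCij
      exact absurd hCij (lt_irrefl 0)

/-- **Cor. 1 on the ring: every normal-operation synchronous state is a STABLE synchronous state
of the damped swing model** (`Mᵢ, Dᵢ > 0`; energy route, census-free; co-rotating frame at the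
synchronous frequency `ω_s = ΣP/ΣD`): the conclusion of `stable_syncSolution_of_normalOperation`
verbatim. «These states … are guaranteed to be stable by corollary 1.»
[cite: ManikTimmeWitthaut2017, §5.4 (p0012 L25–L33) and §3 Cor. 1] -/
theorem loadedRing_normalOperation_stable (hn : 2 ≤ n) (hK : ∀ k, 0 < Kv k)
    (hC : ∀ i j, S.C i j = if j = finRotate (n + 1) i then Kv i
      else if i = finRotate (n + 1) j then Kv j else 0)
    (hM : ∀ i, 0 < S.M i) (hD : ∀ i, 0 < S.D i) {θe : Fin (n + 1) → ℝ}
    (he : ∀ i, S.P i - S.D i * ((∑ j, S.P j) / ∑ j, S.D j) = S.flow θe i)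
    (hno : ∀ k, 0 < Real.cos (θe k - θe (finRotate (n + 1) k))) {ε : ℝ} (hε : 0 < ε) :
    ∃ δ > 0, ∀ x₁ : (Fin (n + 1) → ℝ) × (Fin (n + 1) → ℝ),
      dist x₁ (θe, fun _ => (∑ j, S.P j) / ∑ j, S.D j) < δ →
      (∃ X : ℝ → (Fin (n + 1) → ℝ) × (Fin (n + 1) → ℝ), X 0 = x₁ ∧
          ∀ T : ℝ, ∀ t ∈ Icc 0 T, HasDerivWithinAt X (S.field (X t)) (Icc 0 T) t) ∧
        ∀ X : ℝ → (Fin (n + 1) → ℝ) × (Fin (n + 1) → ℝ), X 0 = x₁ →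
          (∀ T : ℝ, ∀ t ∈ Icc 0 T, HasDerivWithinAt X (S.field (X t)) (Icc 0 T) t) →
          (∀ t, 0 ≤ t → dist ((fun j => (X t).1 j - (∑ j, S.P j) / (∑ j, S.D j) * t),
              (fun j => (X t).2 j - (∑ j, S.P j) / ∑ j, S.D j)) (θe, 0) < ε) ∧
          Tendsto (fun t => ((fun j => (X t).1 j - (∑ j, S.P j) / (∑ j, S.D j) * t),
              (fun j => (X t).2 j - (∑ j, S.P j) / ∑ j, S.D j))) atTop
            (𝓝 ((fun j => θe j + (∑ i, (S.M i * (x₁.2 i - (∑ j, S.P j) / ∑ j, S.D j)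
              + S.D i * (x₁.1 i - θe i))) / ∑ i, S.D i), 0)) :=
  S.stable_syncSolution_of_normalOperation (loadedRing_C_symm S Kv hn hC)
    (loadedRing_C_nonneg S Kv hK hC) (loadedRing_couplingConnected S Kv hn hK hC) hM hD he
    (loadedRing_normalOperation_of_edges S Kv hK hC hno) hε

/-- ★★ **THEOREM 12 WITH COROLLARY 1: the loaded ring carries EXACTLY `⌈ϖ(f_max)⌉ − ⌊ϖ(f_min)⌋ − 1`
normal-operation synchronous states per period, and EVERY ONE OF THEM IS A STABLE SYNCHRONOUS
STATE of the damped swing model.** Ring of `N = n + 1 ≥ 3` machines, capacities `Kₖ > 0`,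
inertias and dampings `Mᵢ, Dᵢ > 0`, arbitrary injections, `F⁰` any reference flow; the count is
that of `loadedRing_census`, the stability that of `loadedRing_normalOperation_stable` (for every
`ε > 0` a `δ > 0` such that from every state within `δ` of `(θ, ω_s𝟙)` a forward-global motion
exists and every one stays, in the co-rotating frame, within `ε` of `(θ, 0)` and converges to the
rotated rest point of its own leaf). THREE COLUMNS: CERTIFIED for MODEL `M` = damped lossless swing
model on a ring of arbitrary positive capacities and injections (MV-1 class, an idealised single
loop); «stable» = synchronous state of MODEL `M`, never a grid; only normal-operation states are
counted. [cite: ManikTimmeWitthaut2017, §5.4 Thm 12 and §3 Cor. 1] -/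
theorem loadedRing_normalOperation_census (hn : 2 ≤ n) (hK : ∀ k, 0 < Kv k)
    (hC : ∀ i j, S.C i j = if j = finRotate (n + 1) i then Kv i
      else if i = finRotate (n + 1) j then Kv j else 0)
    (hM : ∀ i, 0 < S.M i) (hD : ∀ i, 0 < S.D i) {F₀ : Fin (n + 1) → ℝ}
    (hF : ∀ k, S.P k - S.D k * ((∑ j, S.P j) / ∑ j, S.D j)
      = F₀ k - F₀ ((finRotate (n + 1)).symm k)) :
    {θ : Fin (n + 1) → ℝ | θ 0 = 0 ∧ (∀ i, θ i ∈ Set.Ico (-π) π) ∧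
        (∀ k, S.P k - S.D k * ((∑ j, S.P j) / ∑ j, S.D j) = S.flow θ k) ∧
        ∀ k, 0 < Real.cos (θ k - θ (finRotate (n + 1) k))}.ncard
      = (⌈(∑ k, Real.arcsin ((F₀ k
            + Finset.univ.inf' Finset.univ_nonempty (fun k => Kv k - F₀ k)) / Kv k)) / (2 * π)⌉
        - ⌊(∑ k, Real.arcsin ((F₀ k
            + Finset.univ.sup' Finset.univ_nonempty (fun k => -Kv k - F₀ k)) / Kv k)) / (2 * π)⌋
        - 1).toNat ∧
    ∀ θe ∈ {θ : Fin (n + 1) → ℝ | θ 0 = 0 ∧ (∀ i, θ i ∈ Set.Ico (-π) π) ∧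
        (∀ k, S.P k - S.D k * ((∑ j, S.P j) / ∑ j, S.D j) = S.flow θ k) ∧
        ∀ k, 0 < Real.cos (θ k - θ (finRotate (n + 1) k))},
      ∀ ε > 0, ∃ δ > 0, ∀ x₁ : (Fin (n + 1) → ℝ) × (Fin (n + 1) → ℝ),
        dist x₁ (θe, fun _ => (∑ j, S.P j) / ∑ j, S.D j) < δ →
        (∃ X : ℝ → (Fin (n + 1) → ℝ) × (Fin (n + 1) → ℝ), X 0 = x₁ ∧
            ∀ T : ℝ, ∀ t ∈ Icc 0 T, HasDerivWithinAt X (S.field (X t)) (Icc 0 T) t) ∧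
          ∀ X : ℝ → (Fin (n + 1) → ℝ) × (Fin (n + 1) → ℝ), X 0 = x₁ →
            (∀ T : ℝ, ∀ t ∈ Icc 0 T, HasDerivWithinAt X (S.field (X t)) (Icc 0 T) t) →
            (∀ t, 0 ≤ t → dist ((fun j => (X t).1 j - (∑ j, S.P j) / (∑ j, S.D j) * t),
                (fun j => (X t).2 j - (∑ j, S.P j) / ∑ j, S.D j)) (θe, 0) < ε) ∧
            Tendsto (fun t => ((fun j => (X t).1 j - (∑ j, S.P j) / (∑ j, S.D j) * t),
                (fun j => (X t).2 j - (∑ j, S.P j) / ∑ j, S.D j))) atTop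
              (𝓝 ((fun j => θe j + (∑ i, (S.M i * (x₁.2 i - (∑ j, S.P j) / ∑ j, S.D j)
                + S.D i * (x₁.1 i - θe i))) / ∑ i, S.D i), 0)) := by
  refine ⟨loadedRing_census S Kv hn hK hC hF, ?_⟩
  rintro θe ⟨_, _, he, hno⟩ ε hε
  exact loadedRing_normalOperation_stable S Kv hn hK hC hM hD he hno hε

/-! ### §6. Finiteness of the set of pinned normal-operation synchronous states -/

/-- **The pinned normal-operation synchronous states of a loaded ring form a FINITE set** (ring of
`N = n + 1 ≥ 3` machines, capacities `Kₖ > 0`, any reference flow): the winding number of the cycle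
flow, `θ ↦ ⌊W(f_c(θ))/2π⌋`, is INJECTIVE on them («As the winding numbers are unique, the distinct
fixed points correspond to the values of the winding number») and bounded by `|q| ≤ N` — so the
`Set.ncard` counts of this file and of `LoadedRingCensusBounds` are cardinalities of finite sets.
[cite: ManikTimmeWitthaut2017, §5.4 proof of Thm 12 («As the winding numbers are unique …»; the bounded window «ϖ(f^min_c) ≤ ϖ ≤ ϖ(f^max_c)»)] -/
theorem loadedRing_syncStates_finite (hn : 2 ≤ n) (hK : ∀ k, 0 < Kv k)
    (hC : ∀ i j, S.C i j = if j = finRotate (n + 1) i then Kv i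
      else if i = finRotate (n + 1) j then Kv j else 0)
    {F₀ : Fin (n + 1) → ℝ}
    (hF : ∀ k, S.P k - S.D k * ((∑ j, S.P j) / ∑ j, S.D j)
      = F₀ k - F₀ ((finRotate (n + 1)).symm k)) :
    {θ : Fin (n + 1) → ℝ | θ 0 = 0 ∧ (∀ i, θ i ∈ Set.Ico (-π) π) ∧
        (∀ k, S.P k - S.D k * ((∑ j, S.P j) / ∑ j, S.D j) = S.flow θ k) ∧
        ∀ k, 0 < Real.cos (θ k - θ (finRotate (n + 1) k))}.Finite := by
  have hπ := Real.pi_pos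
  have h2π : (0 : ℝ) < 2 * π := by positivity
  -- (A) as in `loadedRing_ncard_syncStates_eq`: cycle flow, admissibility, integer winding number
  have hA : ∀ θ : Fin (n + 1) → ℝ,
      (∀ k, S.P k - S.D k * ((∑ j, S.P j) / ∑ j, S.D j) = S.flow θ k) →
      (∀ k, 0 < Real.cos (θ k - θ (finRotate (n + 1) k))) →
      (∀ k, |F₀ k + (Kv 0 * Real.sin (θ 0 - θ (finRotate (n + 1) 0)) - F₀ 0)| < Kv k) ∧
      ∃ q : ℤ, (∑ k, Real.arcsin ((F₀ k
          + (Kv 0 * Real.sin (θ 0 - θ (finRotate (n + 1) 0)) - F₀ 0)) / Kv k)) = 2 * π * q ∧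
        (⌊(∑ k, Real.arcsin ((F₀ k
          + (Kv 0 * Real.sin (θ 0 - θ (finRotate (n + 1) 0)) - F₀ 0)) / Kv k)) / (2 * π)⌋ = q) ∧
        ∀ k, ∃ m : ℤ, θ k - θ (finRotate (n + 1) k)
          = Real.arcsin ((F₀ k + (Kv 0 * Real.sin (θ 0 - θ (finRotate (n + 1) 0)) - F₀ 0))
              / Kv k) + m * (2 * π) := by
    intro θ he hno
    have hf := loadedRing_edgeFlow_eq S Kv hn hC hF he
    refine ⟨loadedRing_edge_abs_lt Kv hK hf hno, ?_⟩
    obtain ⟨q, hq, hm⟩ := loadedRing_exists_winding Kv hK hf hno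
    refine ⟨q, hq, ?_, hm⟩
    rw [hq, show 2 * π * (q : ℝ) / (2 * π) = q by field_simp]
    exact Int.floor_intCast q
  refine Set.Finite.of_finite_image
    (f := fun θ => ⌊(∑ k, Real.arcsin ((F₀ k
        + (Kv 0 * Real.sin (θ 0 - θ (finRotate (n + 1) 0)) - F₀ 0)) / Kv k)) / (2 * π)⌋) ?_ ?_
  · -- the image lies in the finite window `|q| ≤ n + 1`
    refine (Finset.finite_toSet (Finset.Icc (-((n : ℤ) + 1)) ((n : ℤ) + 1))).subset ?_
    rintro q ⟨θ, ⟨_, _, he, hno⟩, rfl⟩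
    obtain ⟨_, q, hq, hfl, _⟩ := hA θ he hno
    simp only [hfl, Finset.coe_Icc, Set.mem_Icc]
    -- `|2πq| = |W| ≤ (n+1)·π/2`
    have hup : ∑ k, Real.arcsin ((F₀ k
        + (Kv 0 * Real.sin (θ 0 - θ (finRotate (n + 1) 0)) - F₀ 0)) / Kv k)
        ≤ ∑ _k : Fin (n + 1), π / 2 :=
      Finset.sum_le_sum fun k _ => Real.arcsin_le_pi_div_two _
    have hlo : ∑ _k : Fin (n + 1), -(π / 2) ≤ ∑ k, Real.arcsin ((F₀ k
        + (Kv 0 * Real.sin (θ 0 - θ (finRotate (n + 1) 0)) - F₀ 0)) / Kv k) :=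
      Finset.sum_le_sum fun k _ => Real.neg_pi_div_two_le_arcsin _
    rw [Finset.sum_const, Finset.card_univ, Fintype.card_fin, nsmul_eq_mul, hq] at hup hlo
    push_cast at hup hlo
    have h1 : (q : ℝ) ≤ (n : ℝ) + 1 := by nlinarith
    have h2 : -((n : ℝ) + 1) ≤ (q : ℝ) := by nlinarith
    have h1' : q ≤ (n : ℤ) + 1 := by exact_mod_cast h1
    have h2' : -((n : ℤ) + 1) ≤ q := by exact_mod_cast h2
    constructor <;> omega
  · -- injectivity: equal winding numbers ⇒ equal cycle flows ⇒ equal states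
    rintro θ ⟨h0, hbox, he, hno⟩ θ' ⟨h0', hbox', he', hno'⟩ hqq
    obtain ⟨hadm, q, hq, hfl, hm⟩ := hA θ he hno
    obtain ⟨hadm', q', hq', hfl', hm'⟩ := hA θ' he' hno'
    simp only at hqq
    have hqq' : q = q' := by rw [← hfl, ← hfl']; exact hqq
    set f := Kv 0 * Real.sin (θ 0 - θ (finRotate (n + 1) 0)) - F₀ 0 with hfdef
    set f' := Kv 0 * Real.sin (θ' 0 - θ' (finRotate (n + 1) 0)) - F₀ 0 with hf'def
    have hW : ∑ k, Real.arcsin ((F₀ k + f) / Kv k) = ∑ k, Real.arcsin ((F₀ k + f') / Kv k) := by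
      rw [hq, hq', hqq']
    have hle : ∀ k, |F₀ k + f| ≤ Kv k := fun k => (hadm k).le
    have hle' : ∀ k, |F₀ k + f'| ≤ Kv k := fun k => (hadm' k).le
    have hff : f = f' := by
      rcases lt_trichotomy f f' with h | h | h
      · exact absurd hW (windingSum_lt Kv hK h hle hle').ne
      · exact h
      · exact absurd hW.symm (windingSum_lt Kv hK h hle' hle).ne
    refine eq_of_edges_congr h0 h0' hbox hbox' fun k => ?_
    obtain ⟨m, hmk⟩ := hm k
    obtain ⟨m', hmk'⟩ := hm' k
    refine ⟨m - m', ?_⟩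
    rw [hmk, hmk', hff]
    push_cast
    ring

end LoadedRing

end ClassicalModel

end Literature.MathematicalPhysics.PowerSystems

end
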